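import Summits.ABC.ABC.Theses.DefiniteXi
import Summits.ABC.ABC.Theorems.DefiniteXiFreyModularity
import Summits.ABC.ABC.Theorems.DefiniteXiDefiniteRTControlPrimeSmulTransportDeg
import Summits.ABC.ABC.Theorems.DefiniteXiDefiniteRTControlPrimeValTransport
import Summits.ABC.ABC.Theorems.DefiniteXiDefiniteRTControlPrimeFreyScale
import Summits.ABC.ABC.Theorems.DefiniteXiDefiniteRTControlPrimeFreyLocal
import Literature.NumberTheory.EllipticCurves.TakahashiDegreeFormulaCoprimeProofs
import Literature.NumberTheory.EllipticCurves.PastenSpectralDegree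
import Literature.NumberTheory.EllipticCurves.PastenHeightBounds
import Literature.NumberTheory.EllipticCurves.PastenHeightBoundsLemma68LocalProofs
import Literature.NumberTheory.EllipticCurves.LatticeInclusionIsogenyDegreeProofs
import Literature.NumberTheory.EllipticCurves.IsogenyDegreeLatticeIndexProofs
import Literature.NumberTheory.EllipticCurves.ModularCurveManinSemistableBridgeProofs
import Literature.NumberTheory.EllipticCurves.ModularDegreeMinimal
import Literature.NumberTheory.EllipticCurves.IsogenyVariableChangeProofs
import Literature.NumberTheory.EllipticCurves.IsogenyCompProofs
import Literature.NumberTheory.EllipticCurves.IsogenyDualProofs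
import Literature.NumberTheory.EllipticCurves.RationalIsogenyDegreesProofs
import Literature.NumberTheory.DiophantineGeometry.MinimalDiscriminantSmulProofs
import HarnessLib

/-!
# Crux `DefiniteXi.DefiniteRTControlPrime` (stmt-ABC-11338) — CANDIDATE 2-stub skeleton `SketchTwoFacts`
# (stub-ideation k3 gen 11; NOT registered by this seat — for the lead / crux-plan / crux-strategist seat)

Drop-in successor of the registered line `Lines/Sketch.lean` (sha 06bc3b5f…, stubs `stub_takahashi`,
`stub_pasten163`, `stub_pastenLemma68`).  It keeps the first two stubs with VERBATIM names and signatures and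
DELETES `stub_pastenLemma68 : PastenShimura2024_lemma_6_8`: the only use of Lemma 6.8 in `Sketch` (the line
`hval : v_q(Δ_min W⋆) ≤ 163 · v_q(Δ_min E)`) follows from `stub_pasten163` alone, because the Takahashi pivot
`W⋆` and the minimal model `W_m = C • E` are both reached from the lattice-optimal curve `W₀` by the lattice
isogenies `z ↦ (c/c₀) z` of degrees `deg P⋆/deg D₀ ≤ deg D₁/deg D₀ ≤ 163` (H1 + the fact), and a `ℚ`-isogeny of
degree `d` changes `ord_v Δ_min` at a multiplicative place by a factor in `[1/d, d]` (H2, Mazur-free Tate-curve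
lemma `exists_ordMinimalDiscriminant_mul_eq_mul_of_isCyclic`).  Body = the k3-gen-4 companion
`Cruxes/DefiniteRTControlPrime/StubIdeasK3G4PastenLemma68.lean` (H0–H3, `exists_conductorMinimal`,
`DefiniteRTControlPrime_of_two_facts`, all PROVED; re-verified 2026-08-31: rc 0, 0 sorries, axioms
{propext, Classical.choice, Quot.sound}) inlined here because `Cruxes/` modules are not importable on the farm,
plus the two sorried stubs and the composition `DefiniteRTControlPrime_of` concluding the crux BY NAME.
To adopt: `ledger crux write stmt-ABC-11338 Lines/SketchTwoFacts.lean --file <this>` then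
`ledger skeleton check $(ledger crux dir stmt-ABC-11338)/Lines/SketchTwoFacts.lean --crux stmt-ABC-11338`
(or overwrite `Lines/Sketch.lean` after renaming the namespace suffix `SketchTwoFacts ↦ Sketch`).
Trust base after adoption: {`takahashi2001_thm_2_3_of_coprime`, `PastenShimura2024_minimalDegree_le_163_mul`}.
-/

set_option linter.dupNamespace false

noncomputable section

namespace Summit.ABC.ABC.Cruxes.DefiniteRTControlPrime.SketchTwoFacts

open Summit.ABC.ABC.Theses.DefiniteXi
open Literature.NumberTheory.EllipticCurves Literature.NumberTheory.EllipticCurves.ModularForms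
open Literature.NumberTheory.Automorphic
open WeierstrassCurve IsDedekindDomain

/-! ## Stubs: the TWO named facts (formal debt, leaves) — names and signatures VERBATIM as registered
on stmt-ABC-11338 for `Lines/Sketch.lean` (sha 06bc3b5f…); `stub_pastenLemma68` is DELETED, not proved. -/

/-- STUB (named fact, leaf): Takahashi 2001 Thm. 2.3 at `r ∥ N` (`δ · i = h_r · j`, `i j = ord_r Δ_min`,
`i ∣ h_r`) for the optimal curve among the conductor-`N` curves. -/
theorem stub_takahashi : takahashi2001_thm_2_3_of_coprime := by
  sorry

/-- STUB (named fact, leaf): Pasten 2024 §3 p. 13 (Mazur–Kenku): the minimal parametrisation degree of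
a globally minimal curve of the class is `≤ 163 · δ_{1,N}`. -/
theorem stub_pasten163 : PastenShimura2024_minimalDegree_le_163_mul := by
  sorry

/-! ## H0 — kernel of `z ↦ cz` is unchanged by rescaling the source lattice (pure lattice algebra, PROVED) -/

/-- **H0 (rescaling).** If `Λ₀ = c₀ Λ_f` (`c₀ ≠ 0`) then `#ker(z ↦ (c/c₀) z : ℂ/Λ₀ → ℂ/Λ') =
#ker(z ↦ c z : ℂ/Λ_f → ℂ/Λ')`: the two maps differ by the isomorphism `z ↦ c₀ z : ℂ/Λ_f ≅ ℂ/Λ₀`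
(`mulQuotientMap_surjective`; injective by `Λ₀ ⊆ c₀Λ_f`), and `#ker(g ∘ e) = #ker g · #ker e`
(`AddMonoidHom.natCard_ker_comp_of_surjective`) with `#ker e = 1`. PROVED. [folklore] -/
theorem natCard_ker_mulQuotientMap_rescale {Λf Λ₀ Λ' : AddSubgroup ℂ} {c₀ c c' : ℂ}
    (hc₀ : c₀ ≠ 0) (h₀ : ∀ z, z ∈ Λ₀ ↔ ∃ w ∈ Λf, z = c₀ * w) (hcc : c' * c₀ = c)
    {hc : ∀ z ∈ Λf, c * z ∈ Λ'} {hc' : ∀ z ∈ Λ₀, c' * z ∈ Λ'} :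
    Nat.card (mulQuotientMap Λ₀ Λ' c' hc').ker = Nat.card (mulQuotientMap Λf Λ' c hc).ker := by
  -- the isomorphism `e : z ↦ c₀ z : ℂ/Λ_f ≅ ℂ/Λ₀`
  have he : ∀ z ∈ Λf, c₀ * z ∈ Λ₀ := fun z hz => (h₀ _).mpr ⟨z, hz, rfl⟩
  set e := mulQuotientMap Λf Λ₀ c₀ he with he_def
  have hsurj : Function.Surjective e := mulQuotientMap_surjective hc₀
  have hinj : Function.Injective e := by
    rw [← AddMonoidHom.ker_eq_bot_iff, eq_bot_iff]
    intro P hP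
    induction P using QuotientAddGroup.induction_on with
    | H z =>
      rw [AddMonoidHom.mem_ker, he_def, mulQuotientMap_mk, QuotientAddGroup.eq_zero_iff] at hP
      obtain ⟨w, hw, hzw⟩ := (h₀ _).mp hP
      have hzw' : z = w := mul_left_cancel₀ hc₀ hzw
      rw [AddSubgroup.mem_bot, QuotientAddGroup.eq_zero_iff, hzw']
      exact hw
  -- `(z ↦ c' z) ∘ e = (z ↦ c z)` since `c' c₀ = c`
  have hcomp : (mulQuotientMap Λ₀ Λ' c' hc').comp e = mulQuotientMap Λf Λ' c hc := by
    refine AddMonoidHom.ext fun P => ?_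
    induction P using QuotientAddGroup.induction_on with
    | H z =>
      rw [AddMonoidHom.comp_apply, he_def, mulQuotientMap_mk, mulQuotientMap_mk, mulQuotientMap_mk,
        ← mul_assoc, hcc]
  have hker_e : Nat.card e.ker = 1 := by
    rw [(AddMonoidHom.ker_eq_bot_iff e).mpr hinj, AddSubgroup.card_bot]
  rw [← hcomp, AddMonoidHom.natCard_ker_comp_of_surjective _ _ hsurj, hker_e, mul_one]

/-! ## H1 — the lattice isogeny out of the optimal curve, WITH its degree (PROVED) -/

/-- **H1 (optimal isogeny with degree).** For the lattice-optimal datum `(W₀, D₀)` (`Λ_{W₀} = c₀ Λ_f`,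
the conclusion of `exists_optimalDatum'`) and any datum `P` of `W'` with the same newform there is a
`ℚ`-isogeny `ψ : W₀ → W'` with `deg ψ · deg D₀ = deg P`.  Assembly of three tree theorems:
`exists_isogeny_degree_eq_of_isNeronLatticeOf W₀ W' D₀.isNeronLattice P.isNeronLattice (c := P.c / D₀.c)`
(`deg ψ = [ (c₀/c)Λ' : Λ_{W₀} ]` as `relIndex`), `natCard_ker_mulQuotientMap_eq_relIndex`
(`IsogenyDegreeLatticeIndexProofs`) + H0 (`= #ker P.isogenyMap`), and the degree formula
`P.modularDegree_eq_card_ker_mul hf D₀.smul_periodLattice_le hinj D₀.deg_pos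
D₀.finite_setOf_natCard_fiberOrbits_ne` (`deg P = #ker P.isogenyMap · deg D₀`, `hinj` from
`isogenyMap_ker_eq_bot_iff.mpr h₀`).  [cite: Knapp1993, Prop. 12.9(a) and p. 302]
[cite: SilvermanAEC2009, Thm. VI.4.1(b)] -/
theorem exists_isogeny_degree_mul_modularDegree_eq {N : ℕ} [NeZero N]
    {W₀ W' : WeierstrassCurve ℚ} [W₀.IsElliptic] [W'.IsElliptic]
    (D₀ : ModularParametrizationData W₀ N) (P : ModularParametrizationData W' N)
    (h₀ : ∀ z ∈ D₀.L.lattice, ∃ w ∈ periodLattice D₀.f, z = D₀.c * w) (hf : P.f = D₀.f) :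
    ∃ ψ : Isogeny W₀ W', ψ.degree * D₀.modularDegree = P.modularDegree := by
  -- degree formula over the optimal datum: `deg P = #ker(z ↦ c z : ℂ/Λ_f → ℂ/Λ') · deg D₀`
  have hker₀ : D₀.isogenyMap.ker = ⊥ := D₀.isogenyMap_ker_eq_bot_iff.mpr h₀
  have hinj : Function.Injective D₀.isogenyMap := (AddMonoidHom.ker_eq_bot_iff _).mp hker₀
  obtain ⟨-, hdeg⟩ := P.modularDegree_eq_card_ker_mul hf D₀.smul_periodLattice_le hinj
    D₀.deg_pos D₀.finite_setOf_natCard_fiberOrbits_ne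
  -- the lattice isogeny `z ↦ (c/c₀) z : W₀ → W'` and its degree as an index
  have hc₀ : (D₀.c : ℚ) ≠ 0 := by exact_mod_cast D₀.maninConstant_ne_zero_holds
  have hcP : (P.c : ℚ) ≠ 0 := by exact_mod_cast P.maninConstant_ne_zero_holds
  have hc : (P.c : ℚ) / (D₀.c : ℚ) ≠ 0 := div_ne_zero hcP hc₀
  have hcast : (((P.c : ℚ) / (D₀.c : ℚ) : ℚ) : ℂ) = (P.c : ℂ) / (D₀.c : ℂ) := by
    rw [Rat.cast_div, Rat.cast_intCast, Rat.cast_intCast]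
  have hle : ∀ z ∈ D₀.L.lattice, (((P.c : ℚ) / (D₀.c : ℚ) : ℚ) : ℂ) * z ∈ P.L.lattice := by
    intro z hz
    obtain ⟨w, hw, rfl⟩ := h₀ z hz
    have hw' : w ∈ periodLattice P.f := by rw [hf]; exact hw
    rw [hcast, div_mul_eq_mul_div, mul_left_comm, mul_div_cancel_left₀ _ D₀.cast_c_ne_zero]
    exact P.smul_periodLattice_le w hw'
  obtain ⟨ψ, hψ⟩ := exists_isogeny_degree_eq_of_isNeronLatticeOf W₀ W' D₀.isNeronLattice
    P.isNeronLattice hc hle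
  refine ⟨ψ, ?_⟩
  rw [hdeg, hψ, ← natCard_ker_mulQuotientMap_eq_relIndex (hc := hle)]
  congr 1
  -- H0: rescale the source lattice `Λ_{W₀} = c₀ Λ_f` back to `Λ_f`
  have h₀' : ∀ z, z ∈ D₀.L.lattice.toAddSubgroup ↔ ∃ w ∈ periodLattice P.f, z = (D₀.c : ℂ) * w := by
    intro z
    rw [Submodule.mem_toAddSubgroup, hf]
    exact ⟨h₀ z, by rintro ⟨w, hw, rfl⟩; exact D₀.smul_periodLattice_le w hw⟩
  exact natCard_ker_mulQuotientMap_rescale D₀.cast_c_ne_zero h₀'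
    (by rw [hcast]; exact div_mul_cancel₀ _ D₀.cast_c_ne_zero)

/-! ## H2 — Mazur-free valuation transport along an isogeny of known degree (PROVED) -/

/-- **H2 (valuation transport by the degree, no Mazur–Kenku).** Along a `ℚ`-isogeny `ψ : W → W'` of
degree `d`, at a place `v` where `W` is multiplicative: `c_v(W') ≤ d · c_v(W)` and `c_v(W) ≤ d · c_v(W')`
(`c_v = ord_v Δ_min`).  Proof: a cyclic `ψ' : W → W'` with `deg ψ' ∣ d`
(`Isogeny.exists_isCyclic_degree_dvd`), `W'` multiplicative at `v`
(`hasMultiplicativeReductionAt_of_isIsogenous`), and the tree's Tate-curve lemma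
`exists_ordMinimalDiscriminant_mul_eq_mul_of_isCyclic`: `c_v(W) · b = c_v(W') · a`, `ab ∣ deg ψ'`.
[cite: PastenShimura2024, §6.4 (p. 22)] [cite: SilvermanAEC2009, Cor. III.4.11] -/
theorem ordMinimalDiscriminant_le_degree_mul {W W' : WeierstrassCurve ℚ} [W.IsElliptic]
    [W'.IsElliptic] (ψ : Isogeny W W') (v : HeightOneSpectrum ℤ)
    (hv : W.HasMultiplicativeReductionAt v) :
    W'.ordMinimalDiscriminant v ≤ ψ.degree * W.ordMinimalDiscriminant v ∧
      W.ordMinimalDiscriminant v ≤ ψ.degree * W'.ordMinimalDiscriminant v := by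
  obtain ⟨ψ', hcyc, hdvd⟩ := ψ.exists_isCyclic_degree_dvd
  have hv' : W'.HasMultiplicativeReductionAt v :=
    hasMultiplicativeReductionAt_of_isIsogenous ⟨ψ⟩ v hv
  obtain ⟨m, n, hm, hn, hmn, heq⟩ :=
    exists_ordMinimalDiscriminant_mul_eq_mul_of_isCyclic ψ'.degree ψ' hcyc rfl v hv hv'
  -- `heq : c_v(W) · n = c_v(W') · m`, `m n ∣ deg ψ' ∣ deg ψ`
  have hle : m * n ≤ ψ.degree :=
    (Nat.le_of_dvd ψ'.degree_pos hmn).trans (Nat.le_of_dvd ψ.degree_pos hdvd)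
  have hm' : m ≤ ψ.degree := (Nat.le_mul_of_pos_right m hn).trans hle
  have hn' : n ≤ ψ.degree := (Nat.le_mul_of_pos_left n hm).trans hle
  constructor
  · calc W'.ordMinimalDiscriminant v
        ≤ W'.ordMinimalDiscriminant v * m := Nat.le_mul_of_pos_right _ hm
      _ = W.ordMinimalDiscriminant v * n := heq.symm
      _ ≤ W.ordMinimalDiscriminant v * ψ.degree := Nat.mul_le_mul_left _ hn'
      _ = ψ.degree * W.ordMinimalDiscriminant v := Nat.mul_comm _ _
  · calc W.ordMinimalDiscriminant v
        ≤ W.ordMinimalDiscriminant v * n := Nat.le_mul_of_pos_right _ hn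
      _ = W'.ordMinimalDiscriminant v * m := heq
      _ ≤ W'.ordMinimalDiscriminant v * ψ.degree := Nat.mul_le_mul_left _ hm'
      _ = ψ.degree * W'.ordMinimalDiscriminant v := Nat.mul_comm _ _

/-! ## H3 — the replacement of the skeleton's `hval`, from `stub_pasten163` alone (PROVED from H1, H2) -/

/-- **H3 (`hval` without Lemma 6.8).** In the set-up of `Sketch.DefiniteRTControlPrime_of` — `W_m = C • E`
globally minimal of conductor `N`, `D₁` a minimal datum of `W_m`, `(W⋆, P⋆)` the conductor-restricted
optimal pivot with `P⋆.f = D₁.f` — the fact `PastenShimura2024_minimalDegree_le_163_mul` gives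
`v_q(Δ_min W⋆) ≤ 163² · v_q(Δ_min E)` at every odd prime `q ∣ N`:  `E`, hence `W_m`, `W₀`, `W⋆`, are
multiplicative at `q`; the isogenies `ψ₁ : W₀ → W_m`, `ψ⋆ : W₀ → W⋆` of H1 have degrees
`deg D₁/deg D₀ ≤ 163` and `deg P⋆/deg D₀ ≤ deg D₁/deg D₀ ≤ 163`; apply H2 twice and
`ordMinimalDiscriminant_smul_holds` (`c_q(C • E) = c_q(E)`). [cite: PastenShimura2024, §3 p. 13 and §6.4] -/
theorem valTransport_of_pasten163 (h163 : PastenShimura2024_minimalDegree_le_163_mul)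
    (a b : ℤ) (hab : IsCoprime a b) (h0 : a * b * (a + b) ≠ 0) (q : ℕ) (hq : q.Prime)
    (hq2 : q ≠ 2) (hqN : q ∣ (freyCurve a b).conductorNorm ℤ)
    (C : VariableChange ℚ) (hC : (C • freyCurve a b).IsGloballyMinimal) {N : ℕ} [NeZero N]
    (hNm : (C • freyCurve a b).conductorNorm ℤ = N)
    (D₁ : ModularParametrizationData (C • freyCurve a b) N)
    (hD₁min : ∀ D' : ModularParametrizationData (C • freyCurve a b) N,
      D₁.modularDegree ≤ D'.modularDegree)
    {Ws : WeierstrassCurve ℚ} [Ws.IsElliptic] (Ps : ModularParametrizationData Ws N)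
    (hfs : Ps.f = D₁.f)
    (hPsmin : ∀ (W' : WeierstrassCurve ℚ) [W'.IsElliptic], W'.conductorNorm ℤ = N →
      ∀ P' : ModularParametrizationData W' N, P'.f = Ps.f → Ps.modularDegree ≤ P'.modularDegree) :
    (Ws.minimalDiscriminantNorm ℤ).factorization q ≤
      163 * 163 * ((freyCurve a b).minimalDiscriminantNorm ℤ).factorization q := by
  haveI := isElliptic_freyCurve h0
  haveI := hC
  -- the lattice-optimal datum `(W₀, D₀)` of the class and its minimality among ALL data
  obtain ⟨W₀, hW₀, D₀, hf₀, h₀⟩ := D₁.exists_optimalDatum'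
  haveI := hW₀
  have hker₀ : D₀.isogenyMap.ker = ⊥ := D₀.isogenyMap_ker_eq_bot_iff.mpr h₀
  have hmin₀ : ∀ (W' : WeierstrassCurve ℚ) [W'.IsElliptic]
      (D' : ModularParametrizationData W' N), D'.f = D₀.f →
        D₀.modularDegree ≤ D'.modularDegree := fun W' _ D' hD' =>
    D₀.modularDegree_le_of_isogenyMap_ker_eq_bot hker₀ D' hD'
  -- the fact: `deg D₁ ≤ 163 · deg D₀`; conductor-minimality: `deg P⋆ ≤ deg D₁`
  have h163' : D₁.modularDegree ≤ 163 * D₀.modularDegree :=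
    h163 N W₀ (C • freyCurve a b) D₀ D₁ hf₀.symm hmin₀ hD₁min
  have hPs_le : Ps.modularDegree ≤ D₁.modularDegree := hPsmin (C • freyCurve a b) hNm D₁ hfs.symm
  -- H1: the two lattice isogenies out of `W₀`, with degrees `≤ 163`
  obtain ⟨ψ₁, hψ₁⟩ := exists_isogeny_degree_mul_modularDegree_eq D₀ D₁ h₀ hf₀.symm
  obtain ⟨ψs, hψs⟩ := exists_isogeny_degree_mul_modularDegree_eq D₀ Ps h₀ (hfs.trans hf₀.symm)
  have hd₀ : 0 < D₀.modularDegree := D₀.deg_pos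
  have hdeg₁ : ψ₁.degree ≤ 163 :=
    Nat.le_of_mul_le_mul_right (by rw [hψ₁]; exact h163') hd₀
  have hdegs : ψs.degree ≤ 163 :=
    Nat.le_of_mul_le_mul_right (by rw [hψs]; exact hPs_le.trans h163') hd₀
  -- the place over `q`; `E`, `W_m`, `W₀` are multiplicative there
  obtain ⟨v, hv⟩ :
      ∃ v : HeightOneSpectrum ℤ, Rat.HeightOneSpectrum.natGenerator v = q :=
    ⟨(Rat.HeightOneSpectrum.primesEquiv (R := ℤ)).symm ⟨q, hq⟩,
      Rat.natGenerator_primesEquiv_symm ⟨q, hq⟩⟩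
  have hdvd : (q : ℤ) ∣ a * b * (a + b) :=
    Literature.NumberTheory.DiophantineGeometry.dvd_of_dvd_conductorNorm_freyCurve hab h0 hq hq2 hqN
  have hmultE : (freyCurve a b).HasMultiplicativeReductionAt v :=
    Literature.NumberTheory.DiophantineGeometry.hasMultiplicativeReductionAt_freyCurve_of_ne_two
      hab h0 v (hv ▸ hq2) (hv ▸ hdvd)
  have hmultWm : (C • freyCurve a b).HasMultiplicativeReductionAt v :=
    hasMultiplicativeReductionAt_of_isIsogenous (isIsogenous_smul (freyCurve a b) C) v hmultE
  have hmultW₀ : W₀.HasMultiplicativeReductionAt v :=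
    hasMultiplicativeReductionAt_of_isIsogenous (IsIsogenous.symm_of_charZero ⟨ψ₁⟩) v hmultWm
  -- H2 twice
  have h1 : Ws.ordMinimalDiscriminant v ≤ ψs.degree * W₀.ordMinimalDiscriminant v :=
    (ordMinimalDiscriminant_le_degree_mul ψs v hmultW₀).1
  have h2 : W₀.ordMinimalDiscriminant v ≤ ψ₁.degree * (C • freyCurve a b).ordMinimalDiscriminant v :=
    (ordMinimalDiscriminant_le_degree_mul ψ₁ v hmultW₀).2
  have h3 : (C • freyCurve a b).ordMinimalDiscriminant v = (freyCurve a b).ordMinimalDiscriminant v :=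
    WeierstrassCurve.ordMinimalDiscriminant_smul_holds v (freyCurve a b) C
  -- `ord_v Δ_min = v_q |Δ_min|`
  have e1 := factorization_minimalDiscriminantNorm_holds Ws v
  have e2 := factorization_minimalDiscriminantNorm_holds (freyCurve a b) v
  rw [hv] at e1 e2
  rw [e1, e2]
  calc Ws.ordMinimalDiscriminant v ≤ ψs.degree * W₀.ordMinimalDiscriminant v := h1
    _ ≤ 163 * W₀.ordMinimalDiscriminant v := Nat.mul_le_mul_right _ hdegs
    _ ≤ 163 * (ψ₁.degree * (C • freyCurve a b).ordMinimalDiscriminant v) :=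
        Nat.mul_le_mul_left _ h2
    _ ≤ 163 * (163 * (C • freyCurve a b).ordMinimalDiscriminant v) :=
        Nat.mul_le_mul_left _ (Nat.mul_le_mul_right _ hdeg₁)
    _ = 163 * 163 * (freyCurve a b).ordMinimalDiscriminant v := by rw [h3]; ring

/-! ## The conductor-restricted optimal pivot (verbatim from `Lines/Sketch.lean`, proved) -/

theorem exists_conductorMinimal {V : WeierstrassCurve ℚ} [V.IsElliptic] {N : ℕ} [NeZero N]
    (D₁ : ModularParametrizationData V N) (hV : V.conductorNorm ℤ = N) :
    ∃ (Ws : WeierstrassCurve ℚ) (_ : Ws.IsElliptic) (Ps : ModularParametrizationData Ws N),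
      Ws.conductorNorm ℤ = N ∧ Ps.f = D₁.f ∧
      ∀ (W' : WeierstrassCurve ℚ) [W'.IsElliptic], W'.conductorNorm ℤ = N →
        ∀ P' : ModularParametrizationData W' N, P'.f = Ps.f →
          Ps.modularDegree ≤ P'.modularDegree := by
  classical
  set S : Set ℕ := {d | ∃ (W' : WeierstrassCurve ℚ) (_ : W'.IsElliptic)
      (P' : ModularParametrizationData W' N),
      W'.conductorNorm ℤ = N ∧ P'.f = D₁.f ∧ P'.modularDegree = d} with hS_def
  have hS : S.Nonempty := ⟨D₁.modularDegree, V, ‹_›, D₁, hV, rfl, rfl⟩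
  obtain ⟨Ws, hWs, Ps, hNs, hfs, hdeg⟩ := Nat.sInf_mem hS
  refine ⟨Ws, hWs, Ps, hNs, hfs, fun W' _ hW' P' hP' => ?_⟩
  rw [hdeg]
  exact Nat.sInf_le ⟨W', ‹_›, P', hW', hP'.trans hfs, rfl⟩

/-! ## The re-glued composition: the crux from the TWO facts (no Lemma 6.8), `C = 4 · 163³` -/

/-- **`DefiniteRTControlPrime` from Takahashi + Pasten's `163 · δ` bound alone** (PROVED, 0 sorry):
the chain `deg D ≤ 4 deg D₁ ≤ 4·163 deg D₀ ≤ 4·163 deg P⋆ ≤ 4·163 ξ v_q(Δ_min W⋆) ≤ 4·163³ ξ v_q(Δ_min E)`,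
the last step by `valTransport_of_pasten163` instead of `stub_valTransport stub_pastenLemma68`. -/
theorem DefiniteRTControlPrime_of_two_facts (hT : takahashi2001_thm_2_3_of_coprime)
    (h163 : PastenShimura2024_minimalDegree_le_163_mul) : DefiniteRTControlPrime := by
  intro ε hε
  refine ⟨4 * 163 * 163 * 163, ?_⟩
  intro a b hab h0 N _ hN q hq hq2 hqN D hDmin
  obtain ⟨M, hM⟩ := hqN
  rw [mul_comm] at hM
  subst hM
  haveI := isElliptic_freyCurve h0
  have hdiv : M * q / q = M := Nat.mul_div_cancel M hq.pos
  rw [hdiv]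
  have hqN' : q ∣ (freyCurve a b).conductorNorm ℤ := by rw [hN]; exact Dvd.intro_left M rfl
  have hcop : M.Coprime q := by
    have h := Summit.ABC.ABC.Theorems.DefiniteRTControlPrime.stub_freyLocal a b hab h0 q hq hq2 hqN'
    rwa [hN, hdiv] at h
  obtain ⟨C, hC⟩ := hasGlobalMinimalModel_rat_holds (freyCurve a b)
  haveI := hC
  have hNm : (C • freyCurve a b).conductorNorm ℤ = M * q := by rw [conductorNorm_smul_rat, hN]
  have hne : Nonempty (ModularParametrizationData (C • freyCurve a b) (M * q)) :=
    (Summit.ABC.ABC.Theorems.nonempty_modularParametrizationData_smul_iff C).mpr ⟨D⟩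
  obtain ⟨D₁, -, hD₁min⟩ := exists_minimal_datum hne
  obtain ⟨W₀, hW₀, D₀, hf₀, h₀⟩ := D₁.exists_optimalDatum'
  haveI := hW₀
  have hker₀ : D₀.isogenyMap.ker = ⊥ := D₀.isogenyMap_ker_eq_bot_iff.mpr h₀
  have hmin₀ : ∀ (W' : WeierstrassCurve ℚ) [W'.IsElliptic]
      (D' : ModularParametrizationData W' (M * q)), D'.f = D₀.f →
        D₀.modularDegree ≤ D'.modularDegree := fun W' _ D' hD' =>
    D₀.modularDegree_le_of_isogenyMap_ker_eq_bot hker₀ D' hD'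
  have h163' : D₁.modularDegree ≤ 163 * D₀.modularDegree :=
    h163 (M * q) W₀ (C • freyCurve a b) D₀ D₁ hf₀.symm hmin₀ hD₁min
  obtain ⟨Ws, hWs, Ps, hNs, hfs, hPsmin⟩ := exists_conductorMinimal D₁ hNm
  haveI := hWs
  have h0s : D₀.modularDegree ≤ Ps.modularDegree := hmin₀ Ws Ps (hfs.trans hf₀.symm)
  have hTak : Ps.modularDegree ≤ brandtXi M q (fun n => Ws.LFunction n) *
      (Ws.minimalDiscriminantNorm ℤ).factorization q :=
    takahashi2001_thm_2_3_of_coprime.modularDegree_le_brandtXi_mul hT Ws M q hq hcop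
      hNs Ps hPsmin
  have hL : (fun n => Ws.LFunction n) = fun n => (freyCurve a b).LFunction n := by
    funext n
    have h1 := Ps.isNewformOf.2 n
    have h2 := D₁.isNewformOf.2 n
    rw [hfs] at h1
    rw [h1, LFunction_smul] at h2
    exact_mod_cast h2
  rw [hL] at hTak
  -- (T_val) WITHOUT Lemma 6.8
  have hval : (Ws.minimalDiscriminantNorm ℤ).factorization q ≤
      163 * 163 * ((freyCurve a b).minimalDiscriminantNorm ℤ).factorization q :=
    valTransport_of_pasten163 h163 a b hab h0 q hq hq2 hqN' C hC hNm D₁ hD₁min Ps hfs hPsmin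
  obtain ⟨D₁', -, hdeg₁'⟩ :=
    Summit.ABC.ABC.Theorems.DefiniteRTControlPrime.stub_smulTransportDeg C D₁
  have hscale : (C.u : ℚ).num.natAbs ≤ 2 :=
    Summit.ABC.ABC.Theorems.DefiniteRTControlPrime.stub_freyScale a b hab h0 C hC
  have hD : D.deg ≤ 4 * D₁.modularDegree := by
    calc D.deg ≤ D₁'.deg := hDmin D₁'
      _ = (C.u : ℚ).num.natAbs ^ 2 * D₁.deg := hdeg₁'
      _ ≤ 2 ^ 2 * D₁.deg := Nat.mul_le_mul_right _ (Nat.pow_le_pow_left hscale 2)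
      _ = 4 * D₁.modularDegree := by norm_num [ModularParametrizationData.modularDegree]
  set ξ : ℕ := brandtXi M q (fun n => (freyCurve a b).LFunction n) with hξ
  set v : ℕ := ((freyCurve a b).minimalDiscriminantNorm ℤ).factorization q with hv
  have hchain : D.deg ≤ 4 * 163 * 163 * 163 * (ξ * v) :=
    calc D.deg ≤ 4 * D₁.modularDegree := hD
      _ ≤ 4 * (163 * D₀.modularDegree) := Nat.mul_le_mul_left _ h163'
      _ ≤ 4 * (163 * Ps.modularDegree) := Nat.mul_le_mul_left _ (Nat.mul_le_mul_left _ h0s)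
      _ ≤ 4 * (163 * (ξ * (Ws.minimalDiscriminantNorm ℤ).factorization q)) :=
          Nat.mul_le_mul_left _ (Nat.mul_le_mul_left _ hTak)
      _ ≤ 4 * (163 * (ξ * (163 * 163 * v))) :=
          Nat.mul_le_mul_left _ (Nat.mul_le_mul_left _ (Nat.mul_le_mul_left _ hval))
      _ = 4 * 163 * 163 * 163 * (ξ * v) := by ring
  have hN1 : (1 : ℝ) ≤ ((M * q : ℕ) : ℝ) := by
    exact_mod_cast Nat.one_le_iff_ne_zero.mpr (NeZero.ne (M * q))
  have hrpow : (1 : ℝ) ≤ ((M * q : ℕ) : ℝ) ^ ε := Real.one_le_rpow hN1 hε.le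
  have hcast : (D.deg : ℝ) ≤ (4 * 163 * 163 * 163 : ℝ) * ((ξ : ℝ) * (v : ℝ)) := by
    exact_mod_cast hchain
  have hξv : (0 : ℝ) ≤ (ξ : ℝ) * (v : ℝ) := by positivity
  calc (D.deg : ℝ) ≤ (4 * 163 * 163 * 163 : ℝ) * ((ξ : ℝ) * (v : ℝ)) := hcast
    _ = (4 * 163 * 163 * 163 : ℝ) * 1 * ((ξ : ℝ) * (v : ℝ)) := by ring
    _ ≤ (4 * 163 * 163 * 163 : ℝ) * ((M * q : ℕ) : ℝ) ^ ε * ((ξ : ℝ) * (v : ℝ)) := by gcongr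

/-! ## The composition BY NAME (kernel-checked; sorries only inside the two `stub_*`) -/

/-- **The crux from the two stubs**: `DefiniteRTControlPrime_of_two_facts stub_takahashi stub_pasten163`
(`C = 4 · 163³`, `N^ε` idle). -/
theorem DefiniteRTControlPrime_of : DefiniteRTControlPrime :=
  DefiniteRTControlPrime_of_two_facts stub_takahashi stub_pasten163

end Summit.ABC.ABC.Cruxes.DefiniteRTControlPrime.SketchTwoFacts

end
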